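import Literature.Topology.FourManifolds.HomotopySpheresSumENR
import Literature.Topology.FourManifolds.HomotopyTwoSphereNoSaddle
import Literature.Topology.FourManifolds.MorseSingleMinimum
import Literature.Topology.FourManifolds.MorseExistence
import Literature.Topology.FourManifolds.ReebContractible
import Literature.Topology.FourManifolds.HomotopySpheresGroupProofs
import HarnessLib

/-!
# Punctured homotopy `2`-spheres are contractible, from the cancellation of a superfluous minimum

Topic `Literature/Topology/FourManifolds` (the dimension-`2` leaf of the named fact
`Literature.Topology.FourManifolds.HomotopySphere.contractibleSpace_compl_image_ball`,
`HomotopySpheresSum.lean`; Kosinski, *Differential Manifolds* (1993), VI §1).  Everything here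
is **proved**; the one remaining input for `n = 2` is the named fact
`Literature.Topology.FourManifolds.exists_isMorse_ncard_criticalSetOfIndex_zero_add_one_eq 2`
(`MorseSingleMinimum.lean`: cancelling a superfluous minimum against a `1`-handle, Matsumoto,
*An Introduction to Morse Theory* (2001), proof of Thm. 3.35; Milnor 1965, Thm. 8.1), in
place of the classification of surfaces (`nonemptyDiffeomorphSphere_two`):

* `HomotopySphere.contractibleSpace_compl_singleton_two` — for a homotopy `2`-sphere `Σ` and
  `p ∈ Σ`, `Σ ∖ {p}` is contractible: `Σ` is closed, connected, simply connected
  (`HomotopySphere.simplyConnectedSpace`) and oriented (`S.orientation`); by the cancellation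
  fact and the existence of Morse functions (`exists_isMorse_holds`) it carries a Morse function
  with one critical point of index `0` and one of index `2`
  (`exists_isMorse_ncard_criticalSetOfIndex_eq_one_of_facts`), which has no saddle
  (`criticalSetOfIndex_one_eq_empty`, `HomotopyTwoSphereNoSaddle.lean`), hence exactly two
  critical points; with (minus) a gradient-like field this is a Lyapunov pair and Reeb's
  argument gives the contraction (`contractibleSpace_compl_singleton_of_lyapunov_of_connectedSpace`,
  `ReebContractible.lean`; Milnor, *Morse Theory* (1963), Thm. 4.1).
* `HomotopySphere.contractibleSpace_compl_image_ball_two` — with an open disc removed instead of a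
  point (deformation retraction `BallComplement.homotopyEquiv`).
* `HomotopySphere.contractibleSpace_compl_image_ball_of_hurewicz_of_cancel` — **the named fact
  in all dimensions from two leaves**: the vanishing form of the Hurewicz theorem
  (`hurewicz_subsingleton`, `n ≥ 3`, ENR route of `HomotopySpheresSumENR.lean`) and the
  cancellation fact in dimension `2`; dimensions `0`, `1` are theorems of the tree.

## References

* A. A. Kosinski, *Differential Manifolds*, Academic Press (1993), Ch. VI §1. [Kosinski1993]
* Y. Matsumoto, *An Introduction to Morse Theory*, AMS (2001), Thm. 3.35, Thm. 3.6 (Reeb).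
  [Matsumoto2001]
* J. Milnor, *Morse Theory*, Ann. of Math. Studies 51 (1963), Thm. 4.1 (Reeb). [Milnor1963]
* M. Kervaire, J. Milnor, *Groups of homotopy spheres I*, Ann. of Math. 77 (1963), p. 507.
  [KervaireMilnorAnnals1963]
-/

open scoped Manifold ContDiff Topology
open Set Function Filter Metric Module

noncomputable section

namespace Literature.Topology.FourManifolds

/-! ### A Morse function with two critical points: the Lyapunov data of Reeb's theorem -/

section TwoCritical

variable {M : Type*} [TopologicalSpace M] [ChartedSpace (EuclideanSpace ℝ (Fin 2)) M] [IsManifold (𝓡 2) ∞ M]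
  [T2Space M] [CompactSpace M]

/-- **Reeb's theorem for surfaces, contractibility form.**  On a closed connected surface, a
Morse function whose critical set consists of a point `p` of index `0`, a point `q` of index
`2`, and nothing of index `1`, makes the complement of every point contractible (minus a
gradient-like field is a Lyapunov field with the two rest points `p`, `q`;
`contractibleSpace_compl_singleton_of_lyapunov_of_connectedSpace`). [cite: Milnor1963, Thm. 4.1 (Reeb)] [cite: Matsumoto2001, Thm. 3.6] -/
theorem contractibleSpace_compl_singleton_of_two_critical [ConnectedSpace M] {f : M → ℝ}
    (hfM : IsMorse (𝓡 2) f) {pbot ptop : M} (hbot : criticalSetOfIndex (𝓡 2) f 0 = {pbot})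
    (htop : criticalSetOfIndex (𝓡 2) f 2 = {ptop}) (hone : criticalSetOfIndex (𝓡 2) f 1 = ∅)
    (x : M) : ContractibleSpace ↥(({x}ᶜ : Set M)) := by
  classical
  -- the critical set is `{pbot, ptop}`
  have hcrit : ∀ z, IsMCriticalPt (𝓡 2) f z → z = pbot ∨ z = ptop := by
    intro z hz
    have hle := morseIndex_le_finrank (𝓡 2) f z
    rw [finrank_euclideanSpace_fin] at hle
    rcases Nat.lt_or_ge (morseIndex (𝓡 2) f z) 1 with h0 | h1
    · have : z ∈ criticalSetOfIndex (𝓡 2) f 0 := (mem_criticalSetOfIndex).2 ⟨hz, by omega⟩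
      rw [hbot] at this; exact Or.inl this
    rcases h1.eq_or_lt with h1 | h2
    · have : z ∈ criticalSetOfIndex (𝓡 2) f 1 := (mem_criticalSetOfIndex).2 ⟨hz, h1.symm⟩
      rw [hone] at this; exact this.elim
    · have : z ∈ criticalSetOfIndex (𝓡 2) f 2 := (mem_criticalSetOfIndex).2 ⟨hz, by omega⟩
      rw [htop] at this; exact Or.inr this
  have hpbot_mem : pbot ∈ criticalSetOfIndex (𝓡 2) f 0 := by rw [hbot]; exact mem_singleton _
  have hptop_mem : ptop ∈ criticalSetOfIndex (𝓡 2) f 2 := by rw [htop]; exact mem_singleton _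
  have hpq : pbot ≠ ptop := fun h => by
    have h0 := ((mem_criticalSetOfIndex).1 hpbot_mem).2
    have h2 := ((mem_criticalSetOfIndex).1 hptop_mem).2
    rw [h, h2] at h0; exact absurd h0 (by norm_num)
  -- `pbot` is the strict global minimum, `ptop` the strict global maximum
  have hmin : ∀ z, z ≠ pbot → f pbot < f z := by
    have key : ∀ z, IsMinOn f univ z → z = pbot := fun z hz => by
      have hloc : IsLocalMin f z := hz.isLocalMin univ_mem
      have : z ∈ criticalSetOfIndex (𝓡 2) f 0 :=
        (mem_criticalSetOfIndex).2 ⟨IsLocalMin.isMCriticalPt hloc, hfM.morseIndex_eq_zero_of_isLocalMin hloc⟩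
      rw [hbot] at this; exact this
    obtain ⟨x₀, -, hx₀⟩ := isCompact_univ.exists_isMinOn univ_nonempty hfM.contMDiff.continuous.continuousOn
    have hx₀b := key x₀ hx₀
    intro z hz
    have hle : f pbot ≤ f z := by rw [← hx₀b]; exact hx₀ (mem_univ z)
    refine lt_of_le_of_ne hle fun heq => hz (key z fun y _ => ?_)
    rw [← heq, ← hx₀b]; exact hx₀ (mem_univ y)
  have hmax : ∀ z, z ≠ ptop → f z < f ptop := by
    have key : ∀ z, IsMaxOn f univ z → z = ptop := fun z hz => by
      have hloc : IsLocalMax f z := hz.isLocalMax univ_mem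
      have : z ∈ criticalSetOfIndex (𝓡 2) f 2 :=
        (mem_criticalSetOfIndex).2 ⟨IsLocalMax.isMCriticalPt hloc, by
          have := hfM.morseIndex_eq_finrank_of_isLocalMax hloc
          simpa [finrank_euclideanSpace_fin] using this⟩
      rw [htop] at this; exact this
    obtain ⟨y₀, -, hy₀⟩ := isCompact_univ.exists_isMaxOn univ_nonempty hfM.contMDiff.continuous.continuousOn
    have hy₀t := key y₀ hy₀
    intro z hz
    have hle : f z ≤ f ptop := by rw [← hy₀t]; exact hy₀ (mem_univ z)
    refine lt_of_le_of_ne hle fun heq => hz (key z fun y _ => ?_)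
    rw [heq, ← hy₀t]; exact hy₀ (mem_univ y)
  -- the Lyapunov field `-ξ`
  obtain ⟨ξ, hgl⟩ := hfM.exists_isGradientLike fun p _ => BoundarylessManifold.isInteriorPoint
  have hξ : ContMDiff (𝓡 2) (𝓡 2).tangent ∞ fun x => (⟨x, ξ x⟩ : TangentBundle (𝓡 2) M) := ξ.contMDiff
  have hX := hξ.neg_section
  have hXf : ∀ z, z ≠ pbot → z ≠ ptop → mlineDeriv (𝓡 2) f z ((-⇑ξ) z) < 0 := by
    intro z hzb hzt
    have hzc : ¬ IsMCriticalPt (𝓡 2) f z := fun h => by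
      rcases hcrit z h with h' | h'
      · exact hzb h'
      · exact hzt h'
    have hpos := hgl.mlineDeriv_pos z hzc
    have : mlineDeriv (𝓡 2) f z ((-⇑ξ) z) = -mlineDeriv (𝓡 2) f z (ξ z) := by
      show mfderiv (𝓡 2) 𝓘(ℝ, ℝ) f z (-(ξ z)) = -mfderiv (𝓡 2) 𝓘(ℝ, ℝ) f z (ξ z)
      exact map_neg _ _
    rw [this]; linarith
  exact contractibleSpace_compl_singleton_of_lyapunov_of_connectedSpace (E := EuclideanSpace ℝ (Fin 2)) hX hfM.contMDiff
    hXf hmin hmax hpq x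

end TwoCritical

/-! ### Punctured homotopy `2`-spheres -/

namespace HomotopySphere

/-- **A punctured homotopy `2`-sphere is contractible**, GIVEN the cancellation of a superfluous
minimum against a `1`-handle on closed surfaces (the named fact
`exists_isMorse_ncard_criticalSetOfIndex_zero_add_one_eq 2`, Matsumoto 2001, proof of Thm. 3.35):
a homotopy `2`-sphere is closed, connected, simply connected and oriented, so a Morse function on
it with one minimum and one maximum has no saddle (`criticalSetOfIndex_one_eq_empty`) and Reeb's
argument applies. [cite: Kosinski1993, Ch. VI §1 (remark before Cor. 1.4)] [cite: Matsumoto2001, Thm. 3.35 and Thm. 3.6] -/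
theorem contractibleSpace_compl_singleton_two
    (hK : exists_isMorse_ncard_criticalSetOfIndex_zero_add_one_eq.{0} 2) (S : HomotopySphere 2)
    (p : S.carrier) : ContractibleSpace ↥(({p}ᶜ : Set S.carrier)) := by
  haveI := S.simplyConnectedSpace le_rfl
  haveI : ConnectedSpace S.carrier := inferInstance
  obtain ⟨f, hfM, h0, h2⟩ := exists_isMorse_ncard_criticalSetOfIndex_eq_one_of_facts 2
    (exists_isMorse_holds 2) hK S.carrier
  obtain ⟨pbot, hbot⟩ := Set.ncard_eq_one.1 h0
  obtain ⟨ptop, htop⟩ := Set.ncard_eq_one.1 h2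
  have hone := criticalSetOfIndex_one_eq_empty S.orientation hfM hbot htop
  exact contractibleSpace_compl_singleton_of_two_critical hfM hbot htop hone p

/-- **`contractibleSpace_compl_image_ball` in dimension `2`**, GIVEN the cancellation fact: a
homotopy `2`-sphere with an open disc removed is contractible (deformation retract of the
punctured homotopy sphere, `BallComplement.homotopyEquiv`). [cite: Kosinski1993, Ch. VI §1 (remark before Cor. 1.4)] -/
theorem contractibleSpace_compl_image_ball_two
    (hK : exists_isMorse_ncard_criticalSetOfIndex_zero_add_one_eq.{0} 2) (S : HomotopySphere 2)
    {i : EuclideanSpace ℝ (Fin 2) → S.carrier} (hi : Manifold.IsSmoothEmbedding 𝓘(ℝ, EuclideanSpace ℝ (Fin 2)) (𝓡 2) ∞ i) :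
    ContractibleSpace ↥((i '' ball (0 : EuclideanSpace ℝ (Fin 2)) 1)ᶜ) :=
  haveI := contractibleSpace_compl_singleton_two hK S (i 0)
  (Literature.AlgebraicTopology.Homotopy.BallComplement.homotopyEquiv
    (isOpenEmbedding_of_isSmoothEmbedding_euclidean hi)).contractibleSpace

/-- **Punctured homotopy spheres are contractible in all dimensions, from two leaves**: the
vanishing form of the Hurewicz theorem (`Literature.AlgebraicTopology.SingularHomology.hurewicz_subsingleton`,
Hatcher 2002, Thm. 4.32; `n ≥ 3`, ENR route) and the cancellation of a superfluous minimum on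
closed surfaces (`exists_isMorse_ncard_criticalSetOfIndex_zero_add_one_eq 2`, Matsumoto 2001,
Thm. 3.35; `n = 2`, Morse–Reeb route of this file); dimensions `0` and `1` are theorems of the
tree.  This discharges the classification-of-surfaces leaf `nonemptyDiffeomorphSphere_two` of
`contractibleSpace_compl_image_ball_of_hurewicz_of_two`. [cite: Kosinski1993, Ch. VI §1 (remark before Cor. 1.4)] [cite: KervaireMilnorAnnals1963, Lemma 2.4, proof (p. 507)] -/
theorem contractibleSpace_compl_image_ball_of_hurewicz_of_cancel
    (h : Literature.AlgebraicTopology.SingularHomology.hurewicz_subsingleton.{0})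
    (hK : exists_isMorse_ncard_criticalSetOfIndex_zero_add_one_eq.{0} 2) :
    contractibleSpace_compl_image_ball := by
  intro n S i hi
  rcases Nat.lt_or_ge n 3 with hn | hn
  · interval_cases n
    · exact S.contractibleSpace_compl_image_ball_zero i
    · exact S.contractibleSpace_compl_image_ball_one hi
    · exact contractibleSpace_compl_image_ball_two hK S hi
  · exact contractibleSpace_compl_image_ball_of_hurewicz_of_le h hn S hi

/-- The same from the isomorphism clause `hurewicz_iso` (Hatcher Thm. 4.32 as printed) and the
cancellation fact. [cite: Kosinski1993, Ch. VI §1 (remark before Cor. 1.4)] -/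
theorem contractibleSpace_compl_image_ball_of_hurewiczIso_of_cancel
    (h : Literature.AlgebraicTopology.SingularHomology.hurewicz_iso.{0})
    (hK : exists_isMorse_ncard_criticalSetOfIndex_zero_add_one_eq.{0} 2) :
    contractibleSpace_compl_image_ball :=
  contractibleSpace_compl_image_ball_of_hurewicz_of_cancel
    (Literature.AlgebraicTopology.SingularHomology.hurewicz_subsingleton_of_iso h) hK

/-- **The sum of two homotopy spheres is a homotopy sphere** (Kervaire–Milnor 1963, §2, p. 505;
tree fact `HomotopySphere.nonempty_homotopyEquiv_sphere_of_isConnectedSum`, all `n`), from the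
Hurewicz theorem (vanishing form) and the cancellation fact only. [cite: KervaireMilnorAnnals1963, §2 (p. 505)] -/
theorem nonempty_homotopyEquiv_sphere_of_isConnectedSum_of_hurewicz_of_cancel
    (h : Literature.AlgebraicTopology.SingularHomology.hurewicz_subsingleton.{0})
    (hK : exists_isMorse_ncard_criticalSetOfIndex_zero_add_one_eq.{0} 2) :
    nonempty_homotopyEquiv_sphere_of_isConnectedSum :=
  nonempty_homotopyEquiv_sphere_of_isConnectedSum_of
    (contractibleSpace_compl_image_ball_of_hurewicz_of_cancel h hK)

end HomotopySphere

end Literature.Topology.FourManifolds
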